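import Summits.QuantumFields.BalabanUV.Beta.GAN24.StencilSlotVH
import Literature.MathematicalPhysics.QuantumFieldTheory.Balaban1983to89.Beta.AveragingHessianKernelsRooted

/-!
# `BalabanUV.Beta.GAN24.StencilSlotVHRoot` — binder row G-an2-4 / (CONV-C), S-slot AFTER the K-slot: the ROOTED TWIN of `GAN24/StencilSlotVH`
# (p203951) — the (V-H) = BORDER summand with an1's ROOTED border `vhSAt ρ` in place of `vhS`, in BOTH placements: NATIVE (`vhSAt ρ d Lc rfl κ u`,
# the border sector of the literal of record `WardLocusRecursive.SrecAt ρ` and of an2's `SpineRootedStepN.SstepNAt ρ`) and `mfNeg`-ADAPTED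
# (`mfNeg (vhSAt ρ d Lc rfl κ u)`, an2's `SpineRootedStep.SstepAt ρ`) — row SR-L0 «UNITS ENGINE», BORDER LINE, of the row owner's
# `HOME/b2b-balaban-gan24-p1/SKELETON-SREC.md` v0.1 §2; RULINGS-15 (R15-3) «SREC-ROOT» (G-an2-4 swarm leaf seat `b2b-balaban-gan24-formalise-leaf-03`, gen 40)

NOT IN PRINT; OUR BOOKKEEPING (the row owner's `gen6/mkroot.py` METHOD: the proofs of the base module VERBATIM, the border entering only through an1's
ROOTED lemma `AveragingHessianKernelsRooted.locStencil_vhSAt` — box root `r ∈ box (d+1) Lc` — instead of `AveragingHessianKernels.locStencil_vhS`; the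
generic units algebra `StencilSlotVH.unitS_smul_offDiag` / `vh_unit_factor` is used BY NAME, not re-declared).  HONEST FRAMING (cell contract, verbatim):
«discharging `BetaPertH` makes Bałaban's UV stability UNCONDITIONAL — a real constructive-QFT result; it is NOT the continuum limit and NOT the Clay
problem.»  HONEST DEPENDENCY (verbatim): «continuum YM on T⁴ ⇐ BetaPertH ∧ nine spine estimates (0/9 proved); BetaPertH ⇐ (D1) ∧ (D4) ∧ CAP+tail;
G-an2-4 gates asym, D1 and NE2/3/4.»  [folklore] exponent arithmetic on asym1's change of units `HessKerDressedUnits.unitS` at the adopted units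
`CombesThomas.sfStep Lc j = Lc^j`, `smStep d Lc j = Lc^{j(d+1)}` and an2's weight `BalabanStepJetsSucc.wVH d Lc j = (Lc^j)^{2(d+2)}`; no estimate, no
cited fact, no `def`, no `def … : Prop`, no sorry, no wall binder.  Discharges NOTHING of (hS, hSall) on ANY literal ((E) `SrecAt`, an2's `SstepNAt` /
`SstepAt`): the border summand is ONE of three summands of the members `j + 1` (cubic: `GAN24/SrecUnits` p226440; Λ: `GAN24/StencilSlotLamRoot`);
0 wall binders instantiated; NEVER «G-an2-4 closed» as (CONV-C); NOT D1, NOT BetaPertH, NOT continuum, NOT Clay.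

## What is proved (generic `d`, any root offset `ρ` for the algebra, an in-block root `toSite r`, `r ∈ box (d+1) Lc`, for the locality; `NeZero Lc`)
* §1 block support: `vhSAt ρ` (node 7a's packer) and `mfNeg (vhSAt ρ …)` vanish on the `(inl,inl)` and `(inr,inr)` blocks (`rfl`).
* §2 NATIVE placement — **`unitS_vhPiece_eq`**: `unitS (sfStep Lc j) (smStep d Lc j) (fun κ u ↦ (cVH·wVH d Lc j) • vhSAt ρ d Lc rfl κ u) = fun κ u ↦ cVH • vhSAt ρ d Lc rfl κ u`
  for EVERY `j` (the weight is EXACTLY absorbed by the units: `StencilSlotVH.vh_unit_factor`); **`locStencil_unitS_vhPiece`**: for `δ ≥ 0`, `1 ≤ Lc`, `r ∈ box`,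
  `LocStencil (…) (|cVH|·3ℓ²e^{4(d+1)Lcδ}) δ`, `ℓ = ell (d+1) Lc` — an1's `j`-FREE constant; **`unitS_vhPiece_sub_eq_zero`** / **`locStencil_unitS_vhPiece_sub`**:
  the normalised border summands of any two levels `k+j`, `k` COINCIDE — drift constant `0` (`LocStencil (… (k+j) − … k) (0·θ^k) δ`, any `θ`, `δ`).
* §3 the same four statements in the `mfNeg`-ADAPTED placement (`unitS_mfNeg_vhPiece_eq`, `locStencil_unitS_mfNeg_vhPiece`, `unitS_mfNeg_vhPiece_sub_eq_zero`,
  `locStencil_unitS_mfNeg_vhPiece_sub`; an2's `StepJetData.locStencil_mfNeg`).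
So on the rooted literals, as on the base-corner one, the border summand of the S-slot costs bookkeeping only: in the adopted units it is the `j = 0` object
with a `j`-free locality constant and ZERO drift.
-/

noncomputable section

open Literature.MathematicalPhysics.QuantumFieldTheory
open Literature.MathematicalPhysics.QuantumFieldTheory.Balaban1983to89
open Literature.MathematicalPhysics.QuantumFieldTheory.Balaban1983to89.Beta
open ExpKernelCalculus (MKer)
open OneStepResolventKernel (Fib LocStencil)
open AffineAveraging (box toSite)
open StepJetData (mfNeg locStencil_mfNeg locStencil_smul)
open AveragingHessianKernels (ell)
open AveragingHessianKernelsRooted (vhSAt locStencil_vhSAt)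
open BalabanStepJetsSucc (wVH)
open Summit.QuantumFields.BalabanUV.Beta.HessKerDressedUnits (unitS)
open Summit.QuantumFields.BalabanUV.Beta.GAN24.CombesThomas (sfStep smStep)
open Summit.QuantumFields.BalabanUV.Beta.GAN24.StencilSlotVH (unitS_smul_offDiag vh_unit_factor)

namespace Summit.QuantumFields.BalabanUV.Beta.GAN24.StencilSlotVHRoot

variable {d : ℕ}

/-! ## §1 Block support of the rooted border family (both placements) -/

/-- [folklore] `vhSAt ρ` vanishes on the field–field block (node 7a's packer `packVH` does). -/
theorem vhSAt_inl_inl (ρ : Fin (d + 1) → ℤ) (L : ℕ) (κ : Fin (d + 1)) (u x y : Fin (d + 1) → ℤ) (α β : Fin (d + 1)) :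
    vhSAt ρ d L rfl κ u x y (Sum.inl α) (Sum.inl β) = 0 := rfl

/-- [folklore] `vhSAt ρ` vanishes on the multiplier–multiplier block. -/
theorem vhSAt_inr_inr (ρ : Fin (d + 1) → ℤ) (L : ℕ) (κ : Fin (d + 1)) (u x y : Fin (d + 1) → ℤ) (μ ν : Fin (d + 1)) :
    vhSAt ρ d L rfl κ u x y (Sum.inr μ) (Sum.inr ν) = 0 := rfl

/-- [folklore] `mfNeg (vhSAt ρ …)` vanishes on the field–field block. -/
theorem mfNeg_vhSAt_inl_inl (ρ : Fin (d + 1) → ℤ) (L : ℕ) (κ : Fin (d + 1)) (u x y : Fin (d + 1) → ℤ) (α β : Fin (d + 1)) :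
    mfNeg (vhSAt ρ d L rfl κ u) x y (Sum.inl α) (Sum.inl β) = 0 := rfl

/-- [folklore] `mfNeg (vhSAt ρ …)` vanishes on the multiplier–multiplier block. -/
theorem mfNeg_vhSAt_inr_inr (ρ : Fin (d + 1) → ℤ) (L : ℕ) (κ : Fin (d + 1)) (u x y : Fin (d + 1) → ℤ) (μ ν : Fin (d + 1)) :
    mfNeg (vhSAt ρ d L rfl κ u) x y (Sum.inr μ) (Sum.inr ν) = 0 := rfl

/-! ## §2 NATIVE placement: the border sector of `WardLocusRecursive.SrecAt ρ` / `SpineRootedStepN.SstepNAt ρ` in the adopted units -/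

section Native

variable {Lc : ℕ} [NeZero Lc]

/-- [folklore] **THE ROOTED BORDER SUMMAND IS `j`-INDEPENDENT AFTER NORMALISATION** (native placement, any root offset `ρ`): in the K-slot's units
the weighted border summand `(cVH·wVH d Lc j) • vhSAt ρ d Lc rfl κ u` of member `j` equals the bare `cVH • vhSAt ρ d Lc rfl κ u` for every `j`
(`StencilSlotVH.unitS_smul_offDiag` + `vh_unit_factor` BY NAME). -/
theorem unitS_vhPiece_eq (ρ : Fin (d + 1) → ℤ) (cVH : ℝ) (j : ℕ) :
    unitS (sfStep Lc j) (smStep d Lc j) (fun κ u => (cVH * wVH d Lc j) • vhSAt ρ d Lc rfl κ u)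
      = fun κ u => cVH • vhSAt ρ d Lc rfl κ u := by
  rw [unitS_smul_offDiag _ _ _ (fun κ u => vhSAt ρ d Lc rfl κ u) (fun κ u x y α β => vhSAt_inl_inl ρ Lc κ u x y α β)
    (fun κ u x y μ ν => vhSAt_inr_inr ρ Lc κ u x y μ ν)]
  have h : (sfStep Lc j * smStep d Lc j)⁻¹ * ((sfStep Lc j)⁻¹ * (smStep d Lc j)⁻¹) * (cVH * wVH d Lc j) = cVH := by
    calc (sfStep Lc j * smStep d Lc j)⁻¹ * ((sfStep Lc j)⁻¹ * (smStep d Lc j)⁻¹) * (cVH * wVH d Lc j)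
        = cVH * ((sfStep Lc j * smStep d Lc j)⁻¹ * ((sfStep Lc j)⁻¹ * (smStep d Lc j)⁻¹) * wVH d Lc j) := by ring
      _ = cVH := by rw [vh_unit_factor, mul_one]
  rw [h]

/-- [folklore] **`hS`-SHAPE FOR THE ROOTED BORDER SUMMAND, UNIFORMLY IN `j`** (native placement, in-block root): for every `δ ≥ 0`, `1 ≤ Lc`,
`r ∈ box (d+1) Lc` and every `j` the normalised summand is a local stencil family with an1's `j`-free constant `|cVH| · 3ℓ² e^{4(d+1)Lc δ}`,
`ℓ = ell (d+1) Lc` (an1's ROOTED `locStencil_vhSAt`). -/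
theorem locStencil_unitS_vhPiece (hLc : 1 ≤ Lc) {r : Fin (d + 1) → ℕ} (hr : r ∈ box (d + 1) Lc) (cVH : ℝ) {δ : ℝ} (hδ : 0 ≤ δ)
    (j : ℕ) :
    LocStencil (unitS (sfStep Lc j) (smStep d Lc j) (fun κ u => (cVH * wVH d Lc j) • vhSAt (toSite r) d Lc rfl κ u))
      (|cVH| * (3 * (ell (d + 1) Lc : ℝ) ^ 2 * Real.exp (4 * ((d : ℝ) + 1) * Lc * δ))) δ := by
  rw [unitS_vhPiece_eq]
  exact locStencil_smul cVH (locStencil_vhSAt hLc hr hδ)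

/-- [folklore] **ZERO DRIFT** (native placement, any root offset): the normalised rooted border summands of any two levels `k + j` and `k`
coincide — their difference is the zero family. -/
theorem unitS_vhPiece_sub_eq_zero (ρ : Fin (d + 1) → ℤ) (cVH : ℝ) (k j : ℕ) :
    (fun κ u => unitS (sfStep Lc (k + j)) (smStep d Lc (k + j)) (fun κ u => (cVH * wVH d Lc (k + j)) • vhSAt ρ d Lc rfl κ u) κ u
        - unitS (sfStep Lc k) (smStep d Lc k) (fun κ u => (cVH * wVH d Lc k) • vhSAt ρ d Lc rfl κ u) κ u)
      = fun _ _ => 0 := by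
  rw [unitS_vhPiece_eq, unitS_vhPiece_eq]
  funext κ u
  exact sub_self _

/-- [folklore] **`hSall`-SHAPE FOR THE ROOTED BORDER SUMMAND WITH DRIFT CONSTANT `0`** (native placement, any root offset): for every `θ`, `δ`,
`k`, `j`, `LocStencil (normalised summand at k+j − normalised summand at k) (0 · θ^k) δ`. -/
theorem locStencil_unitS_vhPiece_sub (ρ : Fin (d + 1) → ℤ) (cVH θ δ : ℝ) (k j : ℕ) :
    LocStencil (fun κ u => unitS (sfStep Lc (k + j)) (smStep d Lc (k + j)) (fun κ u => (cVH * wVH d Lc (k + j)) • vhSAt ρ d Lc rfl κ u) κ u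
        - unitS (sfStep Lc k) (smStep d Lc k) (fun κ u => (cVH * wVH d Lc k) • vhSAt ρ d Lc rfl κ u) κ u) (0 * θ ^ k) δ := by
  rw [unitS_vhPiece_sub_eq_zero]
  intro κ u x y a b
  simp only [Pi.zero_apply, abs_zero, zero_mul]
  exact le_refl _

end Native

/-! ## §3 `mfNeg`-ADAPTED placement: the border sector of an2's `SpineRootedStep.SstepAt ρ` in the adopted units -/

section Adapted

variable {Lc : ℕ} [NeZero Lc]

/-- [folklore] **THE ADAPTED ROOTED BORDER SUMMAND IS `j`-INDEPENDENT AFTER NORMALISATION** (any root offset `ρ`):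
`unitS (sfStep Lc j) (smStep d Lc j) (fun κ u ↦ (cVH·wVH d Lc j) • mfNeg (vhSAt ρ d Lc rfl κ u)) = fun κ u ↦ cVH • mfNeg (vhSAt ρ d Lc rfl κ u)`. -/
theorem unitS_mfNeg_vhPiece_eq (ρ : Fin (d + 1) → ℤ) (cVH : ℝ) (j : ℕ) :
    unitS (sfStep Lc j) (smStep d Lc j) (fun κ u => (cVH * wVH d Lc j) • mfNeg (vhSAt ρ d Lc rfl κ u))
      = fun κ u => cVH • mfNeg (vhSAt ρ d Lc rfl κ u) := by
  rw [unitS_smul_offDiag _ _ _ (fun κ u => mfNeg (vhSAt ρ d Lc rfl κ u)) (fun κ u x y α β => mfNeg_vhSAt_inl_inl ρ Lc κ u x y α β)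
    (fun κ u x y μ ν => mfNeg_vhSAt_inr_inr ρ Lc κ u x y μ ν)]
  have h : (sfStep Lc j * smStep d Lc j)⁻¹ * ((sfStep Lc j)⁻¹ * (smStep d Lc j)⁻¹) * (cVH * wVH d Lc j) = cVH := by
    calc (sfStep Lc j * smStep d Lc j)⁻¹ * ((sfStep Lc j)⁻¹ * (smStep d Lc j)⁻¹) * (cVH * wVH d Lc j)
        = cVH * ((sfStep Lc j * smStep d Lc j)⁻¹ * ((sfStep Lc j)⁻¹ * (smStep d Lc j)⁻¹) * wVH d Lc j) := by ring
      _ = cVH := by rw [vh_unit_factor, mul_one]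
  rw [h]

/-- [folklore] **`hS`-SHAPE FOR THE ADAPTED ROOTED BORDER SUMMAND, UNIFORMLY IN `j`** (in-block root): for every `δ ≥ 0`, `1 ≤ Lc`, `r ∈ box (d+1) Lc`,
every `j`, constant `|cVH| · 3ℓ² e^{4(d+1)Lc δ}` (an1's `locStencil_vhSAt`, an2's `locStencil_mfNeg`). -/
theorem locStencil_unitS_mfNeg_vhPiece (hLc : 1 ≤ Lc) {r : Fin (d + 1) → ℕ} (hr : r ∈ box (d + 1) Lc) (cVH : ℝ) {δ : ℝ}
    (hδ : 0 ≤ δ) (j : ℕ) :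
    LocStencil (unitS (sfStep Lc j) (smStep d Lc j) (fun κ u => (cVH * wVH d Lc j) • mfNeg (vhSAt (toSite r) d Lc rfl κ u)))
      (|cVH| * (3 * (ell (d + 1) Lc : ℝ) ^ 2 * Real.exp (4 * ((d : ℝ) + 1) * Lc * δ))) δ := by
  rw [unitS_mfNeg_vhPiece_eq]
  exact locStencil_smul cVH (locStencil_mfNeg (locStencil_vhSAt hLc hr hδ))

/-- [folklore] **ZERO DRIFT** (adapted placement, any root offset): the normalised summands of any two levels `k + j` and `k` coincide. -/
theorem unitS_mfNeg_vhPiece_sub_eq_zero (ρ : Fin (d + 1) → ℤ) (cVH : ℝ) (k j : ℕ) :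
    (fun κ u => unitS (sfStep Lc (k + j)) (smStep d Lc (k + j)) (fun κ u => (cVH * wVH d Lc (k + j)) • mfNeg (vhSAt ρ d Lc rfl κ u)) κ u
        - unitS (sfStep Lc k) (smStep d Lc k) (fun κ u => (cVH * wVH d Lc k) • mfNeg (vhSAt ρ d Lc rfl κ u)) κ u)
      = fun _ _ => 0 := by
  rw [unitS_mfNeg_vhPiece_eq, unitS_mfNeg_vhPiece_eq]
  funext κ u
  exact sub_self _

/-- [folklore] **`hSall`-SHAPE FOR THE ADAPTED ROOTED BORDER SUMMAND WITH DRIFT CONSTANT `0`** (any root offset): for every `θ`, `δ`, `k`, `j`,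
`LocStencil (normalised summand at k+j − normalised summand at k) (0 · θ^k) δ`. -/
theorem locStencil_unitS_mfNeg_vhPiece_sub (ρ : Fin (d + 1) → ℤ) (cVH θ δ : ℝ) (k j : ℕ) :
    LocStencil (fun κ u =>
        unitS (sfStep Lc (k + j)) (smStep d Lc (k + j)) (fun κ u => (cVH * wVH d Lc (k + j)) • mfNeg (vhSAt ρ d Lc rfl κ u)) κ u
        - unitS (sfStep Lc k) (smStep d Lc k) (fun κ u => (cVH * wVH d Lc k) • mfNeg (vhSAt ρ d Lc rfl κ u)) κ u) (0 * θ ^ k) δ := by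
  rw [unitS_mfNeg_vhPiece_sub_eq_zero]
  intro κ u x y a b
  simp only [Pi.zero_apply, abs_zero, zero_mul]
  exact le_refl _

end Adapted

end Summit.QuantumFields.BalabanUV.Beta.GAN24.StencilSlotVHRoot

end
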